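import Literature.NumberTheory.Transcendental.BakerQuantMixed
import Literature.NumberTheory.Transcendental.PhilipponZeroEstimateHolds
import Literature.NumberTheory.Transcendental.DiazZeroLemmaProofs
import Mathlib.LinearAlgebra.Dual.Lemmas
import HarnessLib

/-!
# Baker 1975, Ch. 3 — the endgame of Theorem 3.1 through Philippon's zero estimate

Support for the proof of Theorem 3.1 of A. Baker, *Transcendental Number Theory* (1975), Ch. 3
(`Literature.NumberTheory.Transcendental.baker1975_thm_3_1`), zero-estimate line (sequel to
`BakerQuantMixed.lean`). Baker closes the proof (Lemma 7 and §4, pp. 36–38) by extrapolating once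
more to the points `l/k`, re-expanding in powers of `x`, a generalised Vandermonde determinant and
an induction on the number of logarithms. Here instead — as in P. Philippon, M. Waldschmidt,
*Lower bounds for linear forms in logarithms* (New Advances in Transcendence Theory, 1988, Ch. 18),
§3 (Prop. 3.5) and §4 ("the contradiction") — the exact vanishing of Baker's algebraic numbers
`Q(l, m)` (`Data.algVal`) for many `l` and all `|m| ≤ (n+2)T` is fed to **Philippon's zero estimate**
on `G = 𝔾ₐ × 𝔾ₘ^{n+1}` (`Philippon1986_GaGm_holds`, PROVED in the tree), and every possible
obstruction subgroup `G' = V × T'` is shown to violate Philippon's counting inequality, EXCEPT the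
degenerate configuration in which

* `V = 𝔾ₐ` and `Lie G' ⊆ W` — forcing `β₀ = 0` and `(β₁, …, βₙ, -1) ∈ span_ℂ X(T')^⊥⊥ = span_ℂ M`,
  `M` the character group of `T'` (bi-orthogonality in `ℂ^{n+1}`), and
* two of the points `γ_s = (s, α₁ˢ, …)`, `s < S₁`, are congruent modulo `G'` — forcing every `χ ∈ M`
  to be a TORSION CHARACTER of the logarithms: `∑ χⱼ lⱼ ∈ 2πiℚ` (`Setup.torsChars`).

The output `Data.obstruction` is therefore: `β₀ = 0` and `(β, -1) ∈ span_ℂ(torsChars)`, from which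
the sequel derives `Λ' ∈ 2πi · (a fixed ℚ-form in the βⱼ)` and a Liouville contradiction (this is
the rôle of Lemma 3.7 of Philippon–Waldschmidt). PROVED here, besides the main theorem:
`philC`/`philippon` (the zero estimate with a constant symbol `≥ 1`), `succ_pow_le_choose`
(`(X+1)^e ≤ binom(e(X+1), e)`), the dimension bookkeeping (`finrank_Wsub`, `finrank_tangent`,
`finrank_inf_add_one_ge`), the bi-orthogonality lemma `mem_span_intCast_of_forall`, and the reading
of congruences `γ_s ≡ γ_{s'} (mod G')` (`torsChars_of_mk_eq`).

## References

* A. Baker, *Transcendental Number Theory*, CUP 1975, Ch. 3 §§3–4 (pp. 32–38). [BakerTNT1975]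
* P. Philippon, M. Waldschmidt, *Lower bounds for linear forms in logarithms*, New Advances in
  Transcendence Theory (A. Baker, ed.), CUP 1988, Ch. 18, §3 (Prop. 3.5, Lemma 3.7), §4.
* P. Philippon, *Lemmes de zéros dans les groupes algébriques commutatifs*, Bull. Soc. Math.
  France 114 (1986), 355–383, Thm. 2.1. [Philippon1986]
-/

noncomputable section

open Complex Finset

namespace Literature.NumberTheory.Transcendental.Baker1975.Ch3

open GaGm (evalAt invDeriv VanishesToOrder coord ConnAlgSubgroup sumset)

/-! ### Philippon's constant -/

/-- **Philippon's constant** `c(m) ≥ 1` for `𝔾ₐ × 𝔾ₘ^m`: one more than the constant produced by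
`Philippon1986_GaGm_holds` (so that it is `≥ 1`; the counting inequality is only weakened).
[cite: Philippon1986, Thm 2.1] -/
def philC (m : ℕ) : ℕ := Classical.choose (Philippon1986_GaGm_holds m) + 1

/-- `1 ≤ c(m)`. [folklore] -/
theorem one_le_philC (m : ℕ) : 1 ≤ philC m := Nat.le_add_left _ _

/-- **Philippon's zero estimate with the constant `philC m`** (the tree's proved
`Philippon1986_GaGm_holds`, its constant replaced by the larger `philC m`). [cite: Philippon1986, Thm 2.1] -/
theorem philippon (m : ℕ) (D₀ D₁ T : ℕ) (W : Submodule ℂ (ℂ × (Fin m → ℂ))) (S : Set (GaGm m))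
    (P : MvPolynomial (Fin (m + 1)) ℂ) (hD₀ : 1 ≤ D₀) (hD₁ : 1 ≤ D₁) (hW : 0 < Module.finrank ℂ W)
    (hS : S.Finite) (h1 : (1 : GaGm m) ∈ S) (hP : P ≠ 0) (hdeg₀ : P.degreeOf 0 ≤ D₀)
    (hdeg₁ : ∀ s ∈ P.support, ∑ j : Fin m, s (Fin.succ j) ≤ D₁)
    (hvan : ∀ g ∈ sumset S (m + 1), VanishesToOrder P W g ((m + 1) * T + 1)) :
    ∃ H : ConnAlgSubgroup m,
      (∃ g : GaGm m, ∀ h ∈ H.toSubgroup, evalAt P (g * h) = 0) ∧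
      Nat.choose (T + (Module.finrank ℂ W - Module.finrank ℂ ↥(W ⊓ H.tangent)))
          (Module.finrank ℂ W - Module.finrank ℂ ↥(W ⊓ H.tangent)) *
        Set.ncard ((QuotientGroup.mk : GaGm m → GaGm m ⧸ H.toSubgroup) '' S) *
        D₀ ^ H.addDim * D₁ ^ H.torusDim ≤ philC m * D₀ * D₁ ^ m := by
  obtain ⟨H, hg, hineq⟩ := Classical.choose_spec (Philippon1986_GaGm_holds m) D₀ D₁ T W S P hD₀ hD₁ hW
    hS h1 hP hdeg₀ hdeg₁ hvan
  refine ⟨H, hg, hineq.trans ?_⟩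
  unfold philC
  gcongr
  exact Nat.le_succ _

/-! ### An elementary lower bound for binomial coefficients -/

/-- `(X+1)^e ≤ binom(e(X+1), e)` (choose one element in each of `e` blocks of size `X+1`).
[folklore] -/
theorem succ_pow_le_choose (X : ℕ) : ∀ e : ℕ, (X + 1) ^ e ≤ Nat.choose (e * (X + 1)) e
  | 0 => by simp
  | e + 1 => by
    set n := e * (X + 1) + X with hn
    have hn1 : n + 1 = (e + 1) * (X + 1) := by rw [hn]; ring
    have key : Nat.choose (n + 1) (e + 1) = (X + 1) * Nat.choose n e := by
      -- `C(n+1,e+1) (e+1) = (n+1) C(n,e) = (e+1)(X+1) C(n,e)`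
      have h' : Nat.choose (n + 1) (e + 1) * (e + 1) = ((X + 1) * Nat.choose n e) * (e + 1) := by
        rw [← Nat.add_one_mul_choose_eq, hn1]; ring
      exact Nat.eq_of_mul_eq_mul_right (Nat.succ_pos e) h'
    rw [← hn1, key, pow_succ, mul_comm]
    refine Nat.mul_le_mul_left _ ((succ_pow_le_choose X e).trans (Nat.choose_le_choose e ?_))
    rw [hn]; exact Nat.le_add_right _ _

/-- If `e(X+1) ≤ T + e` then `(X+1)^e ≤ binom(T+e, e)`. [folklore] -/
theorem succ_pow_le_choose_add {X e T : ℕ} (h : e * (X + 1) ≤ T + e) :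
    (X + 1) ^ e ≤ Nat.choose (T + e) e :=
  (succ_pow_le_choose X e).trans (Nat.choose_le_choose e h)

/-! ### Dimension bookkeeping -/

/-- `dim (p × q) = dim p + dim q` for submodules. [folklore] -/
theorem finrank_prod_eq' {K E E' : Type*} [Field K] [AddCommGroup E] [Module K E] [AddCommGroup E']
    [Module K E'] (p : Submodule K E) (q : Submodule K E') [FiniteDimensional K p]
    [FiniteDimensional K q] : Module.finrank K (p.prod q) = Module.finrank K p + Module.finrank K q := by
  let f : (p.prod q) →ₗ[K] p × q :=
    { toFun := fun x => (⟨x.1.1, x.2.1⟩, ⟨x.1.2, x.2.2⟩)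
      map_add' := fun _ _ => rfl
      map_smul' := fun _ _ => rfl }
  have hf : Function.Bijective f := by
    constructor
    · rintro ⟨⟨a, b⟩, h⟩ ⟨⟨a', b'⟩, h'⟩ hh
      simp only [f, LinearMap.coe_mk, AddHom.coe_mk, Prod.mk.injEq, Subtype.mk.injEq] at hh
      obtain ⟨rfl, rfl⟩ := hh
      rfl
    · rintro ⟨⟨a, ha⟩, ⟨b, hb⟩⟩
      exact ⟨⟨(a, b), ha, hb⟩, rfl⟩
  rw [(LinearEquiv.ofBijective f hf).finrank_eq, Module.finrank_prod]

/-- **`dim Lie G' = dim V + dim T'`.** [folklore] -/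
theorem finrank_tangent {m : ℕ} (H : ConnAlgSubgroup m) :
    Module.finrank ℂ H.tangent = H.addDim + H.torusDim := by
  rw [ConnAlgSubgroup.tangent, finrank_prod_eq', ConnAlgSubgroup.addDim, ConnAlgSubgroup.torusDim]
  congr 1
  cases H.addPart
  · simp only [Bool.false_eq_true, ↓reduceIte]
    exact finrank_bot ℂ ℂ
  · rw [if_pos rfl, finrank_top]
    exact Module.finrank_self ℂ

/-- `dim T' ≤ m`. [folklore] -/
theorem torusDim_le {m : ℕ} (H : ConnAlgSubgroup m) : H.torusDim ≤ m := by
  have := Submodule.finrank_le H.torusTangent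
  rwa [Module.finrank_fintype_fun_eq_card, Fintype.card_fin] at this

/-- **A full-dimensional torus part has no characters**: `dim T' = m ⇒ M = 0` (a non-zero
`χ ∈ M` is not orthogonal to `χ̄ = χ ∈ ℂ^m`). [folklore] -/
theorem chars_eq_bot_of_torusDim_eq {m : ℕ} (H : ConnAlgSubgroup m) (h : H.torusDim = m) :
    H.chars = ⊥ := by
  have htop : H.torusTangent = ⊤ := by
    apply Submodule.eq_top_of_finrank_eq
    rw [ConnAlgSubgroup.torusDim] at h
    rw [h, Module.finrank_fintype_fun_eq_card, Fintype.card_fin]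
  rw [eq_bot_iff]
  intro χ hχ
  have hv : (fun j => (χ j : ℂ)) ∈ H.torusTangent := by rw [htop]; exact Submodule.mem_top
  have h0 : ∑ j, (χ j : ℂ) * (χ j : ℂ) = 0 := hv χ hχ
  have h0' : ∑ j, ((χ j : ℤ) : ℝ) ^ 2 = 0 := by
    have : ((∑ j, ((χ j : ℤ) : ℝ) ^ 2 : ℝ) : ℂ) = 0 := by
      push_cast
      simpa [sq] using h0
    exact_mod_cast this
  rw [AddSubgroup.mem_bot]
  funext j
  have := (Finset.sum_eq_zero_iff_of_nonneg fun j _ => sq_nonneg (((χ j : ℤ) : ℝ))).mp h0' j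
    (Finset.mem_univ j)
  exact_mod_cast pow_eq_zero_iff (n := 2) (by norm_num) |>.mp this

/-- With `V = 𝔾ₐ` and no characters, `G' = G`. [folklore] -/
theorem mem_toSubgroup_of_top {m : ℕ} (H : ConnAlgSubgroup m) (hadd : H.addPart = true)
    (hch : H.chars = ⊥) (g : GaGm m) : g ∈ H.toSubgroup := by
  refine ⟨fun h => absurd (h.symm.trans hadd) (by simp), fun χ hχ => ?_⟩
  rw [hch, AddSubgroup.mem_bot] at hχ
  subst hχ; simp

/-- **A hyperplane cuts dimensions by at most one**: `dim (W ⊓ V) + 1 ≥ dim V` when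
`dim W + 1 ≥ dim E`. [folklore] -/
theorem finrank_inf_add_one_ge {K E : Type*} [Field K] [AddCommGroup E] [Module K E]
    [FiniteDimensional K E] (W V : Submodule K E) (hW : Module.finrank K E ≤ Module.finrank K W + 1) :
    Module.finrank K V ≤ Module.finrank K ↥(W ⊓ V) + 1 := by
  have h1 := Submodule.finrank_sup_add_finrank_inf_eq W V
  have h2 : Module.finrank K ↥(W ⊔ V) ≤ Module.finrank K E := Submodule.finrank_le _
  omega

namespace Data

variable {S : Setup} (D : Data S) {L : ℕ}

/-- The linear form `u ↦ v_{n+1} - β₀ z₀ - ∑ᵣ βᵣ vᵣ` cutting out `W`. [folklore] -/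
def wForm : (ℂ × (Fin (S.n + 1) → ℂ)) →ₗ[ℂ] ℂ where
  toFun u := u.2 (Fin.last S.n) - D.β₀ * u.1 - ∑ r : Fin S.n, D.β r * u.2 (Fin.castSucc r)
  map_add' u u' := by
    simp only [Prod.snd_add, Pi.add_apply, Prod.fst_add, mul_add, Finset.sum_add_distrib]
    ring
  map_smul' c u := by
    simp only [Prod.smul_snd, Pi.smul_apply, smul_eq_mul, Prod.smul_fst, RingHom.id_apply]
    have : ∑ r : Fin S.n, D.β r * (c * u.2 (Fin.castSucc r)) =
        c * ∑ r : Fin S.n, D.β r * u.2 (Fin.castSucc r) := by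
      rw [Finset.mul_sum]
      exact Finset.sum_congr rfl fun r _ => by ring
    rw [this]
    ring

/-- `W = ker wForm`. [folklore] -/
theorem Wsub_eq_ker : D.Wsub = LinearMap.ker D.wForm := by
  ext u
  rw [mem_Wsub_iff, LinearMap.mem_ker]
  simp only [wForm, LinearMap.coe_mk, AddHom.coe_mk]
  constructor
  · intro h; rw [h]; ring
  · intro h; linear_combination h

/-- **`dim W = n + 1`** (a hyperplane of `ℂ × ℂ^{n+1}`). [folklore] -/
theorem finrank_Wsub : Module.finrank ℂ D.Wsub = S.n + 1 := by
  have hsurj : LinearMap.range D.wForm = ⊤ := by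
    rw [eq_top_iff]
    intro c _
    refine ⟨((0 : ℂ), Pi.single (Fin.last S.n) c), ?_⟩
    simp only [wForm, LinearMap.coe_mk, AddHom.coe_mk, Pi.single_eq_same, mul_zero, sub_zero]
    have : ∀ r : Fin S.n, D.β r * (Pi.single (Fin.last S.n) c : Fin (S.n + 1) → ℂ) (Fin.castSucc r) = 0 :=
      fun r => by rw [Pi.single_eq_of_ne (Fin.castSucc_lt_last r).ne _, mul_zero]
    rw [Finset.sum_eq_zero fun r _ => this r, sub_zero]
  have h := LinearMap.finrank_range_add_finrank_ker D.wForm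
  rw [hsurj, finrank_top, Module.finrank_self, Module.finrank_prod, Module.finrank_self,
    Module.finrank_fintype_fun_eq_card, Fintype.card_fin, ← Wsub_eq_ker] at h
  omega

/-- The ambient dimension `dim (ℂ × ℂ^{n+1}) = n + 2`. [folklore] -/
theorem finrank_lie : Module.finrank ℂ (ℂ × (Fin (S.n + 1) → ℂ)) = S.n + 2 := by
  rw [Module.finrank_prod, Module.finrank_self, Module.finrank_fintype_fun_eq_card, Fintype.card_fin]
  ring

end Data

/-! ### Bi-orthogonality in `ℂ^m` for integer vectors -/

/-- The linear form `v ↦ ∑ⱼ xⱼ vⱼ` attached to `x ∈ ℂ^m`, linearly in `x`. [folklore] -/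
def dotForm (m : ℕ) : (Fin m → ℂ) →ₗ[ℂ] Module.Dual ℂ (Fin m → ℂ) where
  toFun x := ∑ j, x j • LinearMap.proj j
  map_add' x y := by
    simp only [Pi.add_apply, add_smul, Finset.sum_add_distrib]
  map_smul' c x := by
    simp only [Pi.smul_apply, smul_eq_mul, mul_smul, RingHom.id_apply, Finset.smul_sum]

/-- `dotForm x v = ∑ⱼ xⱼ vⱼ`. [folklore] -/
theorem dotForm_apply {m : ℕ} (x v : Fin m → ℂ) : dotForm m x v = ∑ j, x j * v j := by
  simp [dotForm, LinearMap.sum_apply]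

/-- `dotForm` is injective. [folklore] -/
theorem dotForm_injective (m : ℕ) : Function.Injective (dotForm m) := by
  intro x y h
  funext j
  have := LinearMap.congr_fun h (Pi.single j 1)
  rw [dotForm_apply, dotForm_apply] at this
  simpa [Pi.single_apply, Finset.sum_ite_eq'] using this

/-- **Bi-orthogonality**: if `∑ bⱼ vⱼ = 0` for every `v ∈ ℂ^m` orthogonal to all the integer vectors
`χ ∈ M`, then `b ∈ span_ℂ M` (finite-dimensional duality,
`FiniteDimensional.mem_span_of_iInf_ker_le_ker`). [folklore] -/
theorem mem_span_intCast_of_forall {m : ℕ} (M : Set (Fin m → ℤ)) (b : Fin m → ℂ)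
    (h : ∀ v : Fin m → ℂ, (∀ χ ∈ M, ∑ j, (χ j : ℂ) * v j = 0) → ∑ j, b j * v j = 0) :
    b ∈ Submodule.span ℂ ((fun χ : Fin m → ℤ => fun j => (χ j : ℂ)) '' M) := by
  set cast : (Fin m → ℤ) → (Fin m → ℂ) := fun χ j => (χ j : ℂ) with hcast
  have hK : dotForm m b ∈ Submodule.span ℂ (Set.range fun χ : M => dotForm m (cast χ)) := by
    apply FiniteDimensional.mem_span_of_iInf_ker_le_ker
    intro v hv
    rw [LinearMap.mem_ker, dotForm_apply]
    refine h v fun χ hχ => ?_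
    have := (Submodule.mem_iInf _).mp hv ⟨χ, hχ⟩
    rwa [LinearMap.mem_ker, dotForm_apply] at this
  have hrange : (Set.range fun χ : M => dotForm m (cast χ)) = dotForm m '' (cast '' M) := by
    ext φ
    simp only [Set.mem_range, Set.mem_image, Subtype.exists, exists_prop]
    constructor
    · rintro ⟨χ, hχ, rfl⟩; exact ⟨cast χ, ⟨χ, hχ, rfl⟩, rfl⟩
    · rintro ⟨x, ⟨χ, hχ, rfl⟩, rfl⟩; exact ⟨χ, hχ, rfl⟩
  rw [hrange, ← Submodule.map_span] at hK
  obtain ⟨x, hx, hxb⟩ := Submodule.mem_map.mp hK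
  rw [← dotForm_injective m hxb]
  exact hx

/-! ### The torsion characters of the logarithms and the points modulo `G'` -/

namespace Setup

variable (S : Setup)

/-- **The torsion characters of the logarithms**: `χ ∈ ℤ^{n+1}` with `∑ⱼ χⱼ lⱼ ∈ 2πiℚ`, i.e.
`∏ αⱼ^{u χⱼ} = 1` for some `u ≥ 1` — a datum of the FIXED logarithms only. [cite: BakerTNT1975, Ch. 3 §4] -/
def torsChars : Set (Fin (S.n + 1) → ℤ) :=
  {χ | ∃ q : ℚ, ∑ j, (χ j : ℂ) * S.l j = 2 * Real.pi * Complex.I * (q : ℂ)}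

/-- The additive coordinate of `γ_s` is `s`, so `s ↦ γ_s` is injective. [folklore] -/
theorem gpt_injective : Function.Injective S.gpt := by
  intro s s' h
  have := congrArg (fun g : GaGm (S.n + 1) => coord g 0) h
  simp only [coord_gpt_zero, Nat.cast_inj] at this
  exact this

/-- The multiplicative part of `γ_s⁻¹ γ_{s'}` is that of `exp_G(0, (s' - s) l)`. [folklore] -/
theorem snd_gpt_inv_mul (s s' : ℕ) :
    ((S.gpt s)⁻¹ * S.gpt s').2 = (GaGm.exp ((0 : ℂ), fun j => (((s' : ℤ) - s : ℤ) : ℂ) * S.l j)).2 := by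
  funext j
  ext
  simp only [gpt, θ, GaGm.exp, Prod.snd_inv, Prod.snd_mul, Pi.inv_apply, Pi.mul_apply,
    Units.val_mul, Units.val_inv_eq_inv_val, Units.val_mk0, Prod.smul_snd, Pi.smul_apply,
    smul_eq_mul, Int.cast_sub, Int.cast_natCast]
  rw [← Complex.exp_neg, ← Complex.exp_add]
  congr 1
  ring

/-- **Congruent points force torsion characters**: if `γ_s ≡ γ_{s'} (mod G')` with `s ≠ s'` then
every character of `G'` is a torsion character of the logarithms. [cite: BakerTNT1975, Ch. 3 §4] -/
theorem torsChars_of_mk_eq (H : ConnAlgSubgroup (S.n + 1)) {s s' : ℕ} (hss : s ≠ s')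
    (h : (QuotientGroup.mk (S.gpt s) : GaGm (S.n + 1) ⧸ H.toSubgroup) = QuotientGroup.mk (S.gpt s')) :
    ∀ χ ∈ H.chars, χ ∈ S.torsChars := by
  intro χ hχ
  rw [QuotientGroup.eq] at h
  have h2 : ∏ j, (((S.gpt s)⁻¹ * S.gpt s').2 j) ^ (χ j) = 1 := h.2 χ hχ
  rw [snd_gpt_inv_mul, DiazZL.prod_zpow_exp_eq_one_iff] at h2
  obtain ⟨t, ht⟩ := h2
  push_cast at ht
  have hd : ((s' : ℂ) - (s : ℂ)) ≠ 0 := by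
    intro h0
    apply hss
    have : (s' : ℂ) = (s : ℂ) := by linear_combination h0
    exact_mod_cast this.symm
  refine ⟨t / ((s' : ℤ) - s : ℤ), ?_⟩
  have hsum : ∑ j, (χ j : ℂ) * (((s' : ℂ) - (s : ℂ)) * S.l j) =
      ((s' : ℂ) - (s : ℂ)) * ∑ j, (χ j : ℂ) * S.l j := by
    rw [Finset.mul_sum]; exact Finset.sum_congr rfl fun j _ => by ring
  rw [hsum] at ht
  push_cast
  rw [show 2 * (Real.pi : ℂ) * I * ((t : ℂ) / ((s' : ℂ) - (s : ℂ))) =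
      ((t : ℂ) * (2 * Real.pi * I)) / ((s' : ℂ) - (s : ℂ)) by ring, ← ht, mul_div_cancel_left₀ _ hd]

/-- `γ_{∑ sᵢ} = ∏ γ_{sᵢ}`. [folklore] -/
theorem gpt_sum {ι : Type*} (t : Finset ι) (f : ι → ℕ) : S.gpt (∑ i ∈ t, f i) = ∏ i ∈ t, S.gpt (f i) := by
  classical
  induction t using Finset.induction_on with
  | empty => simp
  | insert a t ha ih => rw [Finset.sum_insert ha, Finset.prod_insert ha, S.gpt_add, ih]

/-- The additive coordinate distinguishes the points modulo a subgroup with trivial unipotent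
part: `γ_s ≡ γ_{s'} (mod 0 × T')` forces `s = s'`. [folklore] -/
theorem eq_of_mk_eq_of_addPart (H : ConnAlgSubgroup (S.n + 1)) (hadd : H.addPart = false) {s s' : ℕ}
    (h : (QuotientGroup.mk (S.gpt s) : GaGm (S.n + 1) ⧸ H.toSubgroup) = QuotientGroup.mk (S.gpt s')) :
    s = s' := by
  rw [QuotientGroup.eq] at h
  have h1 : ((S.gpt s)⁻¹ * S.gpt s').1 = 1 := h.1 hadd
  have h2 : Multiplicative.toAdd ((S.gpt s)⁻¹ * S.gpt s').1 = 0 := by rw [h1]; rfl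
  simp only [Setup.gpt, Setup.θ, GaGm.exp, Prod.fst_mul, Prod.fst_inv, toAdd_mul, toAdd_inv,
    toAdd_ofAdd, Prod.smul_fst, smul_eq_mul, mul_one] at h2
  have : (s : ℂ) = s' := by linear_combination -h2
  exact_mod_cast this

end Setup

/-! ### Elementary inequalities for the four non-degenerate cases -/

/-- Cases with `card = S₁ > c D₀`: `c D₀ D₁^m < C S₁ D₁^t` when `D₁^e ≤ C`, `e + t = m`. [folklore] -/
theorem contra_of_card {c D₀ D₁ m S₁ C t e : ℕ} (hD₁ : 1 ≤ D₁) (het : e + t = m) (hC : D₁ ^ e ≤ C)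
    (hS : c * D₀ < S₁) : c * D₀ * D₁ ^ m < C * S₁ * D₁ ^ t :=
  calc c * D₀ * D₁ ^ m < S₁ * D₁ ^ m := mul_lt_mul_of_pos_right hS (pow_pos hD₁ _)
    _ = D₁ ^ e * S₁ * D₁ ^ t := by rw [← het, pow_add]; ring
    _ ≤ C * S₁ * D₁ ^ t := by gcongr

/-- The same with a spare factor `D₁`: `c D₀ D₁^m < C S₁ D₁^t` when `D₁^e ≤ C`, `e + t = m + 1`. [folklore] -/
theorem contra_of_card' {c D₀ D₁ m S₁ C t e : ℕ} (hD₁ : 1 ≤ D₁) (het : e + t = m + 1) (hC : D₁ ^ e ≤ C)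
    (hS : c * D₀ < S₁) : c * D₀ * D₁ ^ m < C * S₁ * D₁ ^ t :=
  calc c * D₀ * D₁ ^ m < S₁ * D₁ ^ m := mul_lt_mul_of_pos_right hS (pow_pos hD₁ _)
    _ ≤ S₁ * D₁ ^ (m + 1) := Nat.mul_le_mul_left _ (Nat.pow_le_pow_right hD₁ (Nat.le_succ m))
    _ = D₁ ^ e * S₁ * D₁ ^ t := by rw [← het, pow_add]; ring
    _ ≤ C * S₁ * D₁ ^ t := by gcongr

/-- The case `V = 𝔾ₐ`, `Lie G' ⊆ W`, `card = S₁ > c D₁`: `c D₀ D₁^m < C S₁ D₀ D₁^t` when `D₁^e ≤ C`,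
`e + t + 1 = m`. [folklore] -/
theorem contra_of_card_add {c D₀ D₁ m S₁ C t e : ℕ} (hD₀ : 1 ≤ D₀) (hD₁ : 1 ≤ D₁) (het : e + t + 1 = m)
    (hC : D₁ ^ e ≤ C) (hS : c * D₁ < S₁) : c * D₀ * D₁ ^ m < C * S₁ * D₀ * D₁ ^ t :=
  calc c * D₀ * D₁ ^ m = (c * D₁) * (D₀ * D₁ ^ (e + t)) := by rw [← het, pow_succ]; ring
    _ < S₁ * (D₀ * D₁ ^ (e + t)) := mul_lt_mul_of_pos_right hS (Nat.mul_pos hD₀ (pow_pos hD₁ _))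
    _ = D₁ ^ e * S₁ * D₀ * D₁ ^ t := by rw [pow_add]; ring
    _ ≤ C * S₁ * D₀ * D₁ ^ t := by gcongr

/-- The case `V = 𝔾ₐ`, `Lie G' ⊄ W` (the binomial factor wins): `c D₀ D₁^m < C N D₀ D₁^t` when
`c D₁^e < C`, `1 ≤ N`, `e + t = m`. [folklore] -/
theorem contra_of_binom {c D₀ D₁ m N C t e : ℕ} (hD₀ : 1 ≤ D₀) (hD₁ : 1 ≤ D₁) (het : e + t = m)
    (hC : c * D₁ ^ e < C) (hN : 1 ≤ N) : c * D₀ * D₁ ^ m < C * N * D₀ * D₁ ^ t :=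
  calc c * D₀ * D₁ ^ m = (c * D₁ ^ e) * (D₀ * D₁ ^ t) := by rw [← het, pow_add]; ring
    _ < C * (D₀ * D₁ ^ t) := mul_lt_mul_of_pos_right hC (Nat.mul_pos hD₀ (pow_pos hD₁ _))
    _ = C * 1 * D₀ * D₁ ^ t := by ring
    _ ≤ C * N * D₀ * D₁ ^ t := by gcongr

namespace Data

variable {S : Setup} (D : Data S) {L : ℕ}

/-- **The coefficient vector `b = (β₁, …, βₙ, -1)` of the logarithms** in
`Λ' = β₀ + ∑ᵣ βᵣ lᵣ - l_{n+1} = β₀ + b · l`. [cite: BakerTNT1975, Ch. 3 §3, eq. (1)] -/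
def bvec : Fin (S.n + 1) → ℂ := fun j => Fin.lastCases (-1) (fun r => D.β r) j

/-- `b_{n+1} = -1`. [folklore] -/
@[simp] theorem bvec_last : D.bvec (Fin.last S.n) = -1 := by
  simp [bvec]

/-- `bᵣ = βᵣ`. [folklore] -/
@[simp] theorem bvec_castSucc (r : Fin S.n) : D.bvec (Fin.castSucc r) = D.β r := by
  simp [bvec]

/-- `Λ' = β₀ + b · l`. [cite: BakerTNT1975, Ch. 3 §3, eq. (1)] -/
theorem Λ'_eq_β₀_add_sum : D.Λ' = D.β₀ + ∑ j, D.bvec j * S.l j := by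
  rw [Λ', Fin.sum_univ_castSucc]
  simp only [bvec_castSucc, bvec_last, neg_mul, one_mul]
  ring

/-- `(0, v) ∈ W ↔ b · v = 0`. [folklore] -/
theorem zero_prod_mem_Wsub_iff (v : Fin (S.n + 1) → ℂ) : ((0 : ℂ), v) ∈ D.Wsub ↔ ∑ j, D.bvec j * v j = 0 := by
  rw [mem_Wsub_iff, Fin.sum_univ_castSucc]
  simp only [bvec_castSucc, bvec_last, mul_zero, zero_add, neg_mul, one_mul]
  constructor
  · intro h; rw [h]; ring
  · intro h; linear_combination -h

/-- **The endgame through the zero estimate** (in place of Baker's Lemma 7 and §4). Let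
`p ≠ 0` be integer coefficients of the auxiliary function (unknowns `Idx`, `L ≥ 1`), and suppose
the algebraic numbers `Q(s, m) = algVal p m s` VANISH for all `s < (n+2) S₁` and all `|m| ≤ (n+2)T`,
where, with `c = philC (n+1)`, `D₀ = h(L+1)`, `D₁ = (n+1)L`: `(n+2)(cD₁ + 1) ≤ T`, `cD₀ < S₁`,
`cD₁ < S₁`. Then Philippon's zero estimate on `𝔾ₐ × 𝔾ₘ^{n+1}` leaves only the degenerate
obstruction: `β₀ = 0` and `b = (β₁, …, βₙ, -1)` lies in the `ℂ`-span of the torsion characters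
`χ` of the logarithms (`∑ χⱼ lⱼ ∈ 2πiℚ`). [cite: BakerTNT1975, Ch. 3 §4] -/
theorem obstruction {p : Idx S.n L D.h → ℤ} (hp : p ≠ 0) (hL : 1 ≤ L) {T S₁ : ℕ}
    (hT : (S.n + 2) * (philC (S.n + 1) * ((S.n + 1) * L) + 1) ≤ T)
    (hS0 : philC (S.n + 1) * (D.h * (L + 1)) < S₁)
    (hS1 : philC (S.n + 1) * ((S.n + 1) * L) < S₁)
    (hvan : ∀ s : ℕ, s < (S.n + 2) * S₁ → ∀ m : Fin (S.n + 1) → ℕ,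
      ∑ i, m i ≤ (S.n + 2) * T → D.algVal p m s = 0) :
    D.β₀ = 0 ∧ D.bvec ∈ Submodule.span ℂ
      ((fun χ : Fin (S.n + 1) → ℤ => fun j => (χ j : ℂ)) '' S.torsChars) := by
  classical
  -- abbreviations and positivity
  set c := philC (S.n + 1) with hc
  set D₀ := D.h * (L + 1) with hD₀
  set D₁ := (S.n + 1) * L with hD₁
  have hc1 : 1 ≤ c := one_le_philC (S.n + 1)
  have hD₀1 : 1 ≤ D₀ := Nat.mul_pos (by have := D.two_le_h; omega) (Nat.succ_pos L)
  have hD₁1 : 1 ≤ D₁ := Nat.mul_pos (Nat.succ_pos _) hL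
  have hS₁ : 0 < S₁ := lt_of_le_of_lt (Nat.zero_le _) hS0
  -- the points `γ_s`, `s < S₁`
  set Sset : Set (GaGm (S.n + 1)) := S.gpt '' ↑(Finset.range S₁) with hSset
  have h1 : (1 : GaGm (S.n + 1)) ∈ Sset := ⟨0, by simp [hS₁], S.gpt_zero⟩
  have hfin : Sset.Finite := (Finset.finite_toSet _).image _
  have hP0 : D.polyOf p ≠ 0 := D.polyOf_ne_zero hp
  have hW : 0 < Module.finrank ℂ D.Wsub := by rw [finrank_Wsub]; exact Nat.succ_pos _
  -- vanishing on `Σ(m+1)` to order `(m+1)T + 1`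
  have hvan' : ∀ g ∈ sumset Sset (S.n + 1 + 1),
      VanishesToOrder (D.polyOf p) D.Wsub g ((S.n + 1 + 1) * T + 1) := by
    rintro g ⟨σ, hσ, rfl⟩
    choose sf hsf hsfeq using hσ
    have hprod : ∏ i, σ i = S.gpt (∑ i, sf i) := by
      rw [S.gpt_sum]; exact Finset.prod_congr rfl fun i _ => (hsfeq i).symm
    rw [hprod]
    refine D.vanishesToOrder_polyOf p _ _ fun m' hm' => hvan _ ?_ m' (Nat.lt_succ_iff.mp hm')
    have hlt : ∀ i, sf i < S₁ := fun i => by simpa using hsf i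
    calc ∑ i, sf i < ∑ _i : Fin (S.n + 1 + 1), S₁ :=
          Finset.sum_lt_sum_of_nonempty Finset.univ_nonempty fun i _ => hlt i
      _ = (S.n + 2) * S₁ := by simp
  obtain ⟨H, ⟨g, hg⟩, hineq⟩ := philippon (S.n + 1) D₀ D₁ T D.Wsub Sset (D.polyOf p) hD₀1 hD₁1 hW hfin
    h1 hP0 (D.degreeOf_zero_polyOf_le p) (D.ydeg_polyOf_le p) hvan'
  rw [D.finrank_Wsub] at hineq
  -- the count `N`
  set N := Set.ncard ((QuotientGroup.mk : GaGm (S.n + 1) → GaGm (S.n + 1) ⧸ H.toSubgroup) '' Sset) with hN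
  have hcardS : Sset.ncard = S₁ := by
    rw [hSset, S.gpt_injective.injOn.ncard_image, Set.ncard_coe_finset, Finset.card_range]
  have hN1 : 1 ≤ N :=
    (Set.ncard_pos (hfin.image _)).mpr ⟨_, ⟨1, h1, rfl⟩⟩
  have hN_of_inj : Set.InjOn (QuotientGroup.mk : GaGm (S.n + 1) → GaGm (S.n + 1) ⧸ H.toSubgroup) Sset →
      N = S₁ :=
    fun hinj => by rw [hN, hinj.ncard_image, hcardS]
  have hinj_of_add : H.addPart = false →
      Set.InjOn (QuotientGroup.mk : GaGm (S.n + 1) → GaGm (S.n + 1) ⧸ H.toSubgroup) Sset := by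
    intro hadd x hx y hy hxy
    obtain ⟨s, _, rfl⟩ := hx
    obtain ⟨s', _, rfl⟩ := hy
    rw [S.eq_of_mk_eq_of_addPart H hadd hxy]
  have htors_of_not_inj :
      ¬ Set.InjOn (QuotientGroup.mk : GaGm (S.n + 1) → GaGm (S.n + 1) ⧸ H.toSubgroup) Sset →
      ∀ χ ∈ H.chars, χ ∈ S.torsChars := by
    intro hni
    simp only [Set.InjOn, not_forall, exists_prop] at hni
    obtain ⟨x, hx, y, hy, hxy, hne⟩ := hni
    obtain ⟨s, _, rfl⟩ := hx
    obtain ⟨s', _, rfl⟩ := hy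
    have hss : s ≠ s' := fun h => hne (by rw [h])
    exact S.torsChars_of_mk_eq H hss hxy
  -- `G' ≠ G`
  have hnot_top : ¬ (H.addPart = true ∧ H.torusDim = S.n + 1) := by
    rintro ⟨hadd, ht⟩
    have hch := chars_eq_bot_of_torusDim_eq H ht
    apply hP0
    apply DiazZL.eq_zero_of_forall_evalAt
    intro u
    have := hg (g⁻¹ * u) (mem_toSubgroup_of_top H hadd hch _)
    rwa [mul_inv_cancel_left] at this
  -- dimensions
  set V := H.tangent with hV
  have hVdim : Module.finrank ℂ V = H.addDim + H.torusDim := finrank_tangent H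
  have htle : H.torusDim ≤ S.n + 1 := torusDim_le H
  set d := Module.finrank ℂ ↥(D.Wsub ⊓ V) with hd
  have hd_le : d ≤ H.addDim + H.torusDim := hVdim ▸ Submodule.finrank_mono inf_le_right
  have hd_ge : H.addDim + H.torusDim ≤ d + 1 :=
    hVdim ▸ finrank_inf_add_one_ge D.Wsub V (by rw [finrank_lie, finrank_Wsub])
  have hVW_of_eq : d = H.addDim + H.torusDim → V ≤ D.Wsub := by
    intro he
    have hfe : Module.finrank ℂ ↥(D.Wsub ⊓ V) = Module.finrank ℂ V := by rw [← hd, he, hVdim]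
    have : D.Wsub ⊓ V = V := Submodule.eq_of_le_of_finrank_eq inf_le_right hfe
    calc V = D.Wsub ⊓ V := this.symm
      _ ≤ D.Wsub := inf_le_left
  -- reading `Lie G' ⊆ W`
  have hβ₀_of_VW : H.addPart = true → V ≤ D.Wsub → D.β₀ = 0 := by
    intro hadd hle
    have hmem : (((1 : ℂ), (0 : Fin (S.n + 1) → ℂ)) : ℂ × (Fin (S.n + 1) → ℂ)) ∈ V := by
      rw [hV, ConnAlgSubgroup.tangent, Submodule.mem_prod, hadd, if_pos rfl]
      exact ⟨Submodule.mem_top, Submodule.zero_mem _⟩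
    have := (D.mem_Wsub_iff _).mp (hle hmem)
    simpa using this.symm
  have hspan_of_VW : V ≤ D.Wsub → D.bvec ∈ Submodule.span ℂ
      ((fun χ : Fin (S.n + 1) → ℤ => fun j => (χ j : ℂ)) '' (H.chars : Set (Fin (S.n + 1) → ℤ))) := by
    intro hle
    refine mem_span_intCast_of_forall _ _ fun v hv => ?_
    have hvT : v ∈ H.torusTangent := hv
    have hmem : (((0 : ℂ), v) : ℂ × (Fin (S.n + 1) → ℂ)) ∈ V := by
      rw [hV, ConnAlgSubgroup.tangent, Submodule.mem_prod]
      refine ⟨?_, hvT⟩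
      split_ifs
      · exact Submodule.mem_top
      · exact Submodule.zero_mem _
    exact (D.zero_prod_mem_Wsub_iff v).mp (hle hmem)
  -- binomial lower bounds
  have hchoose : ∀ e ≤ S.n + 2, (c * D₁ + 1) ^ e ≤ Nat.choose (T + e) e := fun e he =>
    succ_pow_le_choose_add (by nlinarith [hT])
  have hB1 : ∀ e, 1 ≤ e → e ≤ S.n + 2 → c * D₁ ^ e < Nat.choose (T + e) e := by
    intro e he1 he
    calc c * D₁ ^ e ≤ c ^ e * D₁ ^ e := Nat.mul_le_mul_right _ (Nat.le_self_pow (by omega) c)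
      _ = (c * D₁) ^ e := (mul_pow c D₁ e).symm
      _ < (c * D₁ + 1) ^ e := Nat.pow_lt_pow_left (Nat.lt_succ_self _) (by omega)
      _ ≤ Nat.choose (T + e) e := hchoose e he
  have hB2 : ∀ e ≤ S.n + 2, D₁ ^ e ≤ Nat.choose (T + e) e := fun e he =>
    (Nat.pow_le_pow_left (by nlinarith) e).trans (hchoose e he)
  -- the case analysis
  by_cases hVW : V ≤ D.Wsub
  · have hdeq : d = H.addDim + H.torusDim := by
      refine le_antisymm hd_le ?_
      rw [hd, ← hVdim]
      exact Submodule.finrank_mono (le_inf hVW le_rfl)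
    cases hadd : H.addPart
    · -- `V = 0`, `Lie G' ⊆ W`: the count `S₁` wins
      exfalso
      have ha : H.addDim = 0 := by simp [ConnAlgSubgroup.addDim, hadd]
      rw [hN_of_inj (hinj_of_add hadd), ha, pow_zero, mul_one] at hineq
      rw [ha, zero_add] at hdeq
      have key : c * D₀ * D₁ ^ (S.n + 1) <
          Nat.choose (T + (S.n + 1 - d)) (S.n + 1 - d) * S₁ * D₁ ^ H.torusDim :=
        contra_of_card hD₁1 (by omega) (hB2 _ (by omega)) hS0
      exact absurd hineq (not_le.mpr key)
    · by_cases hinj : Set.InjOn (QuotientGroup.mk : GaGm (S.n + 1) → GaGm (S.n + 1) ⧸ H.toSubgroup) Sset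
      · -- `V = 𝔾ₐ`, `Lie G' ⊆ W`, distinct classes: the count `S₁` wins
        exfalso
        have ha : H.addDim = 1 := by simp [ConnAlgSubgroup.addDim, hadd]
        have ht : H.torusDim + 1 ≤ S.n + 1 := by
          rcases Nat.lt_or_ge H.torusDim (S.n + 1) with h | h
          · omega
          · exact absurd ⟨hadd, le_antisymm htle h⟩ hnot_top
        rw [hN_of_inj hinj, ha, pow_one] at hineq
        rw [ha] at hdeq
        have key : c * D₀ * D₁ ^ (S.n + 1) <
            Nat.choose (T + (S.n + 1 - d)) (S.n + 1 - d) * S₁ * D₀ * D₁ ^ H.torusDim :=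
          contra_of_card_add hD₀1 hD₁1 (by omega) (hB2 _ (by omega)) hS1
        exact absurd hineq (not_le.mpr key)
      · -- the degenerate configuration
        exact ⟨hβ₀_of_VW hadd hVW, Submodule.span_mono (Set.image_mono (htors_of_not_inj hinj))
          (hspan_of_VW hVW)⟩
  · exfalso
    have hdeq : d + 1 = H.addDim + H.torusDim := by
      have : d ≠ H.addDim + H.torusDim := fun he => hVW (hVW_of_eq he)
      omega
    cases hadd : H.addPart
    · -- `V = 0`, `Lie G' ⊄ W`: the count `S₁` wins (with a spare `D₁`)
      have ha : H.addDim = 0 := by simp [ConnAlgSubgroup.addDim, hadd]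
      rw [hN_of_inj (hinj_of_add hadd), ha, pow_zero, mul_one] at hineq
      rw [ha, zero_add] at hdeq
      have key : c * D₀ * D₁ ^ (S.n + 1) <
          Nat.choose (T + (S.n + 1 - d)) (S.n + 1 - d) * S₁ * D₁ ^ H.torusDim :=
        contra_of_card' hD₁1 (by omega) (hB2 _ (by omega)) hS0
      exact absurd hineq (not_le.mpr key)
    · -- `V = 𝔾ₐ`, `Lie G' ⊄ W`: the binomial factor wins
      have ha : H.addDim = 1 := by simp [ConnAlgSubgroup.addDim, hadd]
      have ht : H.torusDim + 1 ≤ S.n + 1 := by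
        rcases Nat.lt_or_ge H.torusDim (S.n + 1) with h | h
        · omega
        · exact absurd ⟨hadd, le_antisymm htle h⟩ hnot_top
      rw [ha, pow_one] at hineq
      rw [ha] at hdeq
      have key : c * D₀ * D₁ ^ (S.n + 1) <
          Nat.choose (T + (S.n + 1 - d)) (S.n + 1 - d) * N * D₀ * D₁ ^ H.torusDim :=
        contra_of_binom hD₀1 hD₁1 (by omega) (hB1 _ (by omega) (by omega)) hN1
      exact absurd hineq (not_le.mpr key)

end Data

end Literature.NumberTheory.Transcendental.Baker1975.Ch3
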